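import Mathlib
import HarnessLib
import HarnessLib.Audit
import Summits.KontsevichZagierPeriods.Statement
import Literature.NumberTheory.Transcendental.OnePeriods
import Literature.NumberTheory.EllipticCurves.RealLatticePeriod

/-!
Route: SmoothStones

CLOSED (retired) 2026-08-15T13:48:37Z by operator:999:1257524 — reason: not-a-thesis: assembly does not conclude the sub-problem Statement — note: D-0027 §2.1 audit (human 2026-08-15: routes that do not decide the summit are removed): the assembly concludes `SmoothOvalSector`, not the sub-problem statement; a NEW conforming route may be opened from the same idea (generated `closes : … → _root_.KontsevichZagierPeriods`).. The file is kept as the record of this route; refuted decls are indexed as negative knowledge (`ledger negatives`).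

# Route SmoothStones — Smooth stones are complete periods — the Leibniz–Newton sector of Conjecture
1 splits into bounding (ℚ̄π) and abelian stones; no smooth stone is rational

A SMOOTH STONE is a compact planar set σ = closure(interior σ) whose frontier lies in the smooth
real locus {p = 0, ∇p ≠ 0} of a plane curve p ∈ ℚ[x, y]; its frontier is then a finite union of
smooth ovals and, after ONE Newton–Leibniz move with the given polynomial primitive y (Green), its
area is a COMPLETE 1-period Σ ± ∮ x dy — a period of [0 → J(U)] for the smooth affine curve U
carrying the ovals: no weight-0 part, no boundary divisor, no tangential base point (card
smooth-stones-never-rational-weight-floor, realised here as a typed SECTOR route). It suffices — for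
this sector, which is a literal special case of the summit (support SectorOfSummit) and the
closed-path sub-case of HodgeLevel's crux PlanarAreas — to show X = SmoothOvalSector: two
integrand-1 representations over smooth stones with the same area are KZ-equivalent. X =
BoundingStonePairs ∧ AbelianStonePairs along the value dichotomy 'Area ∈ ℚ̄·π or not' (Assembly,
excluded middle): bounding stones (all genus-0 stones, one-oval dividing curves) are certified by
residues, abelian stones by correspondences between generalised Jacobians (Huber–Wüstholz: every
ℚ̄-linear relation among complete periods is of this origin). Two calibration theorems ride along,
both provable modulo cited 1-period transcendence: SmoothStonesTranscendental (Leibniz's 1691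
problem for whole ovals: a smooth stone never has algebraic area — HW Cor. 13.13 inlined as
hypothesis) and WeierstrassStoneNotBaker (a smooth cubic stone is not γ + β·π: Masser II/III, tree
facts), which by soundness separate the sector from every polygon, lune and disc. X does not imply
the summit; the summit implies X.
Lean: `∀ (r r' : Literature.NumberTheory.Transcendental.KZ.IntegralRep 2), (∀ x ∈ r.domain,
r.integrand x = 1) → (∀ x ∈ r'.domain, r'.integrand x = 1) → (IsCompact r.domain ∧ closure (interior
r.domain) = r.domain ∧ (interior r.domain).Nonempty ∧ ∃ p : MvPolynomial (Fin 2) ℚ, frontier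
r.domain ⊆ {x | MvPolynomial.aeval x p = 0 ∧ ∃ i, MvPolynomial.aeval x (MvPolynomial.pderiv i p) ≠
0}) → (IsCompact r'.domain ∧ closure (interior r'.domain) = r'.domain ∧ (interior
r'.domain).Nonempty ∧ ∃ p : MvPolynomial (Fin 2) ℚ, frontier r'.domain ⊆ {x | MvPolynomial.aeval x p
= 0 ∧ ∃ i, MvPolynomial.aeval x (MvPolynomial.pderiv i p) ≠ 0}) → r.value = r'.value →
Literature.NumberTheory.Transcendental.KZ.Equivalent r r'`

## Assembly
Pure logic (excluded middle on `∃ β, IsAlgebraic ℚ β ∧ r.value = β·π`), proved in the folder's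
Sketch.lean as `assembly_holds` (4 lines): BoundingStonePairs handles the pairs whose common area is
an algebraic multiple of π, AbelianStonePairs the others. The assembly ends in the SECTOR target
SmoothOvalSector, not in the summit: this is a sector route (like TerasomaCovering /
PhiFourLaboratory); the converse direction `KontsevichZagierPeriods → SmoothOvalSector` is the
support item SectorOfSummit. GreenBridge is the common first move of cruxes 2–4; GenusZeroStonePairs
is the rational special case of BoundingStonePairs; SmoothStonesTranscendental and
WeierstrassStoneNotBaker are value-side calibrations (by soundness they yield ¬KZ.Equivalent between
any smooth stone and any algebraic-area figure, and between Weierstrass stones and discs/lunes) and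
do not enter the assembly.

Rationale: WHY THIS LINE. Mechanism: boundary regularity of a volume representation bounds the weight floor of
its value — a smooth real boundary puts the boundary cycle inside the smooth locus, so Green's
formula (one `newtonLeibnizRel` instance per cylindrical cell, primitive y) turns the area into a
period of a rational 1-form over CLOSED paths on a smooth curve (Deligne: no weight below 1),
whereas corners/edges produce open paths, weight 0, algebraic summands and logarithms (Arnold1990
§30: the nodal lemniscate y² = x² − x⁴ has algebraic segment areas and a loop of area 2/3;
Hippocrates' lunes). Imported from transcendence theory: Huber–Wüstholz's theorems on 1-periods
(HuberWustholz2022 Thm 9.10, Thm 13.9, Cor. 13.13 'a period over a closed path is transcendental or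
zero' — read pp. 125–128; Wustholz1989) and Masser1975 Thm II/III (tree facts
`masser_ellipticPeriods`, `masser_ellipticPeriods_cm`); from real algebraic geometry: cylindrical
decomposition and rational/dividing real curves (BochnakCosteRoy1998, BasuPollackRoy2006);
historical frame: Newton's Lemma XXVIII (smooth ovals are not algebraically integrable) and
Leibniz's 1691 problem 'areas of segments of rational curves cut by algebraic lines are
transcendental', reported open in Arnold1990 (§31, footnote) and settled at value level by HW Thm
13.9. What no prior route does: LowDimension stops at d ≤ 1 (Baker) and is blocked; HodgeLevel
states PlanarAreas (all planar sets, XL) through the level lemma; HermiteRigidity /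
IsogenyCertificates / MultivaluedCoV supply genus-1 engines; nobody isolates the COMPLETE-period
sub-sector, where Huber–Wüstholz's relation theory is simplest (no boundary divisor: relations =
exact forms + residues + correspondences), splits it by the decidable value class Area ∈ ℚ̄π
(SertozOuaknineWorrell2025), or records that the sector is semantically disjoint from all cornered
rational figures (no smooth stone is squarable or rational — Masser2026 is the nearest print,
paywalled, acq-02462). Negatives index: empty (0 refuted statements, checked 2026-08-15).

RANKED CRUXES. #0 SmoothOvalSector (target) — Conjecture 1 on the smooth-stone sector: two
2-dimensional integral representations with integrand 1 whose domains are smooth stones (compact,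
regular closed, frontier in the smooth real locus of some p ∈ ℚ[x,y]) and with equal value are
KZ-equivalent. (why it might fail: It is Conjecture 1 verbatim on a sector: false iff two smooth
stones of equal area are not connected by the fixed H21 calculus (e.g. a one-oval dividing sextic
stone of area βπ vs a disc, if cut-surface Stokes is not a chain of moves) — then the summit is
false too.) [KontsevichZagier2001, HuberWustholz2022, Arnold1990]
#2 AbelianStonePairs (crux) — The abelian half (card (S), hardest): two smooth stones with equal
area NOT of the form β·π (β real algebraic) are KZ-equivalent. After the Green move both areas are
complete periods of second/third-kind forms on smooth curves of genus ≥ 1; by Huber–Wüstholz the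
equality is induced by exact forms, residues and a correspondence / endomorphism between the
generalised Jacobians (incl. isogenies, CM, decomposable Jacobians as in HW Ex. 14.5(3): y² = x⁶+1 →
y² = x³+1); the claim is that every such certificate is a chain of moves (fold maps (x,y) ↦ (x²,y)
are single 2-dim changes of variables on half-stones; general correspondences act sheetwise as in
route MultivaluedCoV; isogenies as in IsogenyCertificates/HermiteRigidity). Test pairs: {x⁴+y² ≤ 1}
(area 4ϖ/3) against Weierstrass stones of y² = x³ − x; the genus-2 stone {x⁶ + y² ≤ 1} (area
(2/3)B(1/6,3/2) = 3.6429759718) against stones of its elliptic quotients. [deps: GreenBridge]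
[difficulty: XL] (why it might fail: HW relations among complete periods also involve non-split
torus extensions of J(C) (third-kind parts of x dy at the points at infinity) and CM/isogeny
factors; one equal-area pair whose certificate no sheetwise correspondence + plane Stokes chain
realises refutes it (and the summit).) [HuberWustholz2022, Masser1975, SertozOuaknineWorrell2025,
KontsevichZagier2001]
#3 BoundingStonePairs (crux) — The bounding half: two smooth stones with equal area of the form β·π
(β real algebraic) are KZ-equivalent. This is the case where the oriented boundary cycle bounds in
the complexified curve and Area = 2πi·Σ residues of x dy (all genus-0 stones: ellipses, ovals of
rational quartics with non-real or acnodal singularities; ovals of one-oval dividing curves of even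
genus); the chain must realise the residue theorem — by a rational parametrisation (genus 0, crux 4)
or by Stokes on a semialgebraic 2-chain of the complex curve in ℝ⁴ (UnfoldedStokes' engine) — and
then connect two π-multiples (disc normal form: [K,1] ~ dilate of the unit disc by √β, one change of
variables with algebraic Jacobian). [deps: GreenBridge, GenusZeroStonePairs] [difficulty: L] (why it
might fail: Area = βπ is certified by residues on a 2-chain in the complexified curve; as moves this
needs Stokes on a semialgebraic 2-chain in ℝ⁴ (open crux of UnfoldedStokes) or a parametrisation;
the first non-rational instance (one-oval dividing sextic, genus 2) may admit neither.)
[HuberWustholz2022, KontsevichZagier2001, Arnold1990, BochnakCosteRoy1998]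
#4 GenusZeroStonePairs (crux) — Genus-zero stones (special case of crux 3, first to attack): if the
frontiers of both stones are covered by finitely many real-algebraically parametrised rational arcs
t ↦ (u(t)/w(t), v(t)/w(t)) (u, v, w ∈ (ℚ̄∩ℝ)[t], w without real zeros), equal area implies
KZ-equivalence. Plan: Green move (support GreenBridge), then the parametrisation is ONE change of
variables per oval turning ∮ x dy into the 1-dim representation [ℝ, (u/w)·(v/w)′] with rational
integrand over ℚ̄∩ℝ, value β·π by residues (β = 2i·Σ_{Im>0} res, real algebraic, > 0); two such
representations with equal value are connected by LowDimension's d = 1 machinery (partial fractions,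
Möbius changes of variables preserving dt/(1+t²), Baker only for bookkeeping since both values are
rational multiples of the same π·β). [deps: GreenBridge] [difficulty: M] (why it might fail: After
Green + parametrisation both areas are ∫_ℝ R(t)dt, R ∈ (ℚ̄∩ℝ)(t); connecting two such reps is
LowDimension's open d = 1 transfer for ℚ̄-coefficient rational integrands on ℝ (log-divergent
partial fractions must pair up inside absolutely convergent reps).) [KontsevichZagier2001,
Baker1975, Arnold1990, HuberWustholz2022]
#5 SmoothStonesTranscendental (crux) — Leibniz's problem for whole ovals (card (T1a), 'a smooth
stone never weighs an algebraic amount'): ASSUMING the plane-curve closed-path form of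
Huber–Wüstholz 2022 Cor. 13.13 / Thm 9.10, inlined as the hypothesis (for p, A, B ∈ ℚ[x,y] and
finitely many C¹ closed loops γᵢ in the smooth complex locus of p = 0, an algebraic value of Σ nᵢ
∮_γᵢ (A dx + B dy) is zero), every smooth stone σ has transcendental area. Proof: frontier σ =
finitely many smooth ovals (local one-sidedness of a regular closed set along a smooth arc), Area(σ)
= Σ ± ∮ x dy > 0 (Green / Fubini cell by cell), apply the hypothesis with A = 0, B = x. The
hypothesis is to be vendored as a Literature fact (cite item filed); by soundness
(`KZ.Equivalent.value_eq_holds`) the theorem separates every smooth stone from every representation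
with algebraic value (polygons, Arnold's nodal loop of area 2/3). [difficulty: L] (why it might
fail: Only via a bookkeeping leak — 'frontier of a compact regular-closed set in the smooth real
locus = finitely many whole ovals and Area = Σ±∮x dy' (Green for semialgebraic stones) — or if the
inlined plane-curve closed-path form overstated HW Cor. 13.13 for reducible p (checked vs Thm 9.10:
no).) [HuberWustholz2022, Wustholz1989, Arnold1990, Masser2026]
#9 ConicStones (support) — Sanity anchor of the sector (d = 2 analogue of LowDimension's DimZero):
two smooth stones cut by conics (p of total degree ≤ 2, i.e. filled ellipses over ℚ) with equal area
are KZ-equivalent — one affine change of variables with real-algebraic entries and Jacobian ±1 (its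
graph is ℚ-semialgebraic), e.g. {x²+4y² ≤ 4} ~ {x²+y² ≤ 2} via (x,y) ↦ (x/√2, √2·y). [difficulty:
provable-now] [KontsevichZagier2001, BochnakCosteRoy1998]
#9 WeierstrassStoneNotBaker (support) — Card (T1c) typed over the tree's facts: for a real lattice L
with rational invariants q₂, q₃ and positive discriminant (f = 4x³ − q₂x − q₃ with real roots e₃ <
e₂ < e₁), the Weierstrass stone {(x,y) : y² ≤ f(x), x < e₁} = {e₃ ≤ x ≤ e₂, y² ≤ f(x)} has area
2∫_{e₃}^{e₂} √f = −(2/5)q₂·H − (3/5)q₃·Ω₀, where Ω₀ = 2∫_{e₃}^{e₂} dx/√f is the least real period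
(tree fact `PeriodPair.IsReal.integral_inv_sqrt_cubic_of_discr_pos`) and H = 2∫_{e₃}^{e₂} x dx/√f
the quasi-period of the same cycle (from d(xy) = (10x³ − (3/2)q₂x − q₃)dx/y; checked numerically to
5·10⁻¹³ for q₂ = 28, q₃ = −24: Ω₀ = 2.0189058200, H = −1.2325555232, Area = 42.876865668); hence, by
Masser's Theorems II and III (ℚ̄-independence of 1, 2πi, ω₁, η₁, tree corollary
`qbarLinearIndependent_one_twoPiI_ω₁_η₁`) and (q₂,q₃) ≠ (0,0), the area is never γ + β·π with β, γ
real algebraic: a smooth cubic stone is neither rational nor commensurable with the disc.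
[difficulty: L] [Masser1975, Lawden1989, HuberWustholz2022, KontsevichZagier2001]
#9 GreenBridge (support) — The Green move inside the rules (card W1): every integrand-1
representation over a smooth stone is congruent modulo `KZ.relations` to a ℤ-combination of
1-dimensional representations (typed loosely; the intended chain produces integrands that are
differences y_top(x) − y_bot(x) of two real branches of the boundary curve over x-intervals:
cylindrical decomposition of the stone into vertical bands — rule 1a, null walls are relations — and
ONE Newton–Leibniz move per band with the polynomial primitive F = y; provers of cruxes 2–4 re-prove
the sharp form they need with `--supports`). [difficulty: M] [KontsevichZagier2001,
BasuPollackRoy2006, BochnakCosteRoy1998]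
#9 SectorOfSummit (support) — The sector is a literal special case of the summit: integrand 1 is
KZ-rational (p = q = 1), so `KontsevichZagierPeriods → SmoothOvalSector` (three lines, proved in the
folder's Sketch.lean as `sectorOfSummit_holds`); it makes the kill criterion formal
(¬SmoothOvalSector ⇒ ¬summit). [difficulty: provable-now] [KontsevichZagier2001]

TWO-LAYER PLAN. Foreseen glued splits (k ≤ 3, depth 1), filed only after a crux closes or stalls
with a census: BoundingStonePairs ⇐ GenusZeroStonePairs → DividingStonePairs → BoundingGlue, where
DividingStonePairs = the positive-genus bounding case (one-oval dividing curves; engine: Stokes on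
the bounding 2-chain of the complexified curve, shared with route UnfoldedStokes) and BoundingGlue =
'a bounding stone is genus-0 or dividing-type' (real algebraic geometry: Klein/Rokhlin type of the
curve). AbelianStonePairs ⇐ SameCurveStones (two stones on one curve: exact forms + endomorphisms/CM
of one generalised Jacobian) → CorrespondenceStones (different curves: Hom(J₁,J₂) realised by
sheetwise changes of variables, MultivaluedCoV's move) → AbelianGlue (HW: these exhaust the
relations among complete periods, HuberWustholz2022 Ch. 14–15 as a named fact). GenusZeroStonePairs
⇐ GreenBridge → RationalOvalToLine (parametrisation CoV: stone ~ [ℝ, R(t)]) → LowDimension's d = 1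
transfer restricted to values in ℚ̄·π.

KILL CRITERIA. (1) An equal-area pair of smooth stones proved NOT KZ-equivalent (any invariant of
the four move sets finer than area on this sector) closes the route `refuted:SmoothOvalSector` — and
refutes the H21-literal summit (hand the witness to route Neg / the operator via SectorOfSummit).
(2) ¬BoundingStonePairs or ¬AbelianStonePairs alone: same effect (each is a sub-case of the summit);
if the refutation only shows that a PARTICULAR engine (parametrisation, plane Stokes, sheetwise
correspondence) cannot produce the chain, it is a census, not a kill — pivot the crux text, keep the
statement. (3) A smooth stone with ALGEBRAIC area (60-digit PSLQ hit, then a proof) refutes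
SmoothStonesTranscendental's bookkeeping or Huber–Wüstholz — close
`refuted:SmoothStonesTranscendental` and report upstream (it would be a counterexample to HW Cor.
13.13 as read). (4) Mooted: PlanarAreas (HodgeLevel #4) proved ⇒ X follows (close superseded --by
route-KontsevichZagierPeriods-HodgeLevel); the summit proved ⇒ everything here is a corollary.

NOT DECOMPOSED YET. The positive-genus bounding case and the same-curve/different-curve split of the
abelian case (Two-layer plan) — children only after GenusZeroStonePairs or GreenBridge lands
(D-0019). The value DICHOTOMY 'Area ∈ ℚ̄·π or Area outside the Baker space ℚ̄ + Σℚ̄·log' (card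
(T1b)) and CornersCarryLogs (card (T2): c ≥ 2 transversal corners ⇒ Area is a period of [ℤ^(c−1) →
J(U)], Baker/algebraic summands allowed) need Huber–Wüstholz Thm 9.10 for general 1-motives as a
named fact with 1-motive vocabulary the tree lacks — recorded, not filed. The n ≥ 3 conjecture
SmoothBodies (a compact body in ℝⁿ with smooth real-algebraic boundary over ℚ has volume among the
periods of H^(n−1) of a smooth affine variety, hence — under Grothendieck's period conjecture —
never algebraic: tori 2π²Rr², balls 4π/3; Archimedes/Vassiliev: in odd dimensions the cut volume can
even be an algebraic FUNCTION of the cutting plane, yet its values at algebraic planes stay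
transcendental) is GPC-strength for surfaces (K3/abelian-surface periods) and stays in this
paragraph; its rules shadow NoSmoothChainToPolytope needs 'moves are morphisms of motives' (Ψ, card
kz-coaction-devissage D4), untypeable today. The Green move for n ≥ 3 (Gauss: vol = ∫_∂K x₁dx₂…dxₙ)
is not filed either.

CHEAPEST FALSIFIER. For the calibration: compute areas of a dozen smooth stones of degree 4–6 over ℚ
to 60 digits (holonomic period ODEs, Lairez–Mezzarobba–Safey El Din as used in
BreidingKohnSturmfels2024, whose 'TV screen' {x⁴+y⁴ ≤ 1} has area Γ(¼)²/(2√π) = 3.7081493546) and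
PSLQ each against (1, π, π², log 2, log 3, √2, √3): ONE algebraic or Baker hit kills
SmoothStonesTranscendental's reading (done by hand here for {x⁴+y² ≤ 1} = 4ϖ/3 = 3.4960767391,
{x⁶+y² ≤ 1} = 3.6429759718, the Weierstrass stone of 4x³ − 28x + 24 = 42.876865668 = −(2/5)·28·H +
(3/5)·24·Ω₀: all consistent). For the sector: take the genus-0 quartic stone bounded by the rational
curve t ↦ ((1−t²)/(1+t²)², 2t/(1+t²)²)-type bean (area βπ, β ∈ ℚ) and write the chain to the disc of
radius √β by hand — Green (2 bands), one parametrisation CoV, partial fractions over ℚ(i), Möbius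
moves; if the log-divergent pieces cannot be paired inside absolutely convergent 1-dim
representations, GenusZeroStonePairs already needs a 2-dim detour and rank 4 is mis-set.

NUMBERS. ϖ = Γ(¼)²/(2√(2π)) = 2.6220575543; Area{x⁴+y² ≤ 1} = 4ϖ/3 = 3.4960767391 (genus 1, CM by
i); Area{x⁴+y⁴ ≤ 1} = Γ(¼)²/(2√π) = 3.7081493546 (BreidingKohnSturmfels2024: 3.70815); Area{x⁶+y² ≤
1} = (2/3)·B(1/6, 3/2) = 3.6429759718 (genus 2, Jacobian isogenous to E×E′); Weierstrass stone of y²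
= 4x³ − 28x + 24 (roots −3, 1, 2; g₂ = 28, g₃ = −24, no CM, HodgeLevel's test curve): Ω₀ =
2.0189058200, H = −1.2325555232, Area = 42.876865668 = −(2/5)g₂H − (3/5)g₃Ω₀ (verified to 5·10⁻¹³);
Arnold's nodal loop {y² ≤ x² − x⁴, x ≥ 0}: area 2/3 (corner at the node — excluded from the sector,
consistent with crux 5); unit disc π; Hippocrates' lune: rational area with two corners.

DEFINITION REQUESTS. (1) Cite fact wanted (filed after open as `--kind cite`):
`completePlaneCurvePeriods_zero_or_transcendental` in Literature/NumberTheory/Transcendental — the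
hypothesis of SmoothStonesTranscendental verbatim (HuberWustholz2022 Cor. 13.13 with Thm 9.10 for
several components; Wustholz1989), so that the crux can later be restated as `(h : fact) → …`. (2)
No new definition is requested: the smooth-stone predicate is inlined in every item (IsCompact σ ∧
closure (interior σ) = σ ∧ (interior σ).Nonempty ∧ ∃ p, frontier σ ⊆ {p = 0 ∧ ∇p ≠ 0}); a
convenience `def IsSmoothStone` may be introduced by the first prover in Theorems/ with an `iff` to
the inlined text. (3) Wanted later (not filed): Huber–Wüstholz Thm 9.10 for general 1-motives (needs
1-motive vocabulary) for the dichotomy / CornersCarryLogs items of 'Not decomposed yet'.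

Novelty: Searches (2026-08-15): `lit galaxy search --star all` ×7 ('transcendence of the area bounded by an
algebraic curve' 0; 'periods of closed paths' 0; 'area of an oval transcendental' 0; 'transcendence
of areas' 1 → Serfati, Leibniz and the invention of transcendence; 'integral over a closed path is
either zero or transcendental' 0; 'algebraically integrable ovals' / 'algebraically integrable
bodies' / "Newton's lemma XXVIII" → panama:365596206170185 = pdf:4360107500 Arnold1990, READ §§25–31
pp. 47–59 of the pdf: Newton's theorem, Leibniz's 1691 problem 'still, it seems, unsolved',
Vassiliev on integrable bodies); `lit read book:huber2022-transcendence-linear-relations-1-periods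
--grep closed path|vanish|…` (145 hits; pp. 125–128 READ: Thm 13.9, Prop 13.11, Cor 13.13, Exx.
14.5); `lit frontier KontsevichZagierPeriods --since 2020` (30 rows; none on areas/ovals:
arXiv:2303.05030 Kummer-surface GPC, arXiv:2302.07650 periods of rational forms); `lit bridges
KontsevichZagierPeriods --cross any` (30 rows, none relevant); `lit read doi:10.4064/aa250815-9-11`
(Masser2026, paywalled, acq-02462 joined); `lit search` ×2 (searchd rc 75 both times this session —
recorded, not worked around); hub: all 56 Theses headers, HodgeLevel/LowDimension/HermiteRigidity in
full, 132-card index, negatives (0).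
Nearest prior art found: HuberWustholz2022 (doi:10.1017/9781009019729) Thm 13.9 / Cor. 13.13 — the
transcendence input, states nothing about areas or KZ rules; Arnold1990 (doi:10.1007/978-3-0348-9  [refs: 10.4064/aa250815-9-11`, 10.1017/9781009019729, 10.1007/978-3-0348-9129-5, 10.4064/aa250815-9-11, 2303.05030, 2302.07650, book:huber2022-transcendence-linear-relations-1-periods, doi:10.4064/aa250815-9-11, doi:10.1017/9781009019729, doi:10.1007/978-3-0348-9129-5, Arnold1990, Masser2026, HuberWustholz2022, BreidingKohnSturmfels2024]

Barriers (technique_class: one-period-transfer; sector-decomposition): - technique_class: one-period-transfer; sector-decomposition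
- Literature.Barriers.KontsevichZagierPeriods.kzConjecture_implies_oddZetaAlgIndep: evaded by the
sector itself — values of smooth-stone representations are complete 1-periods of curves (weights 1–2
after the Green move), so ζ(3), MZVs and K3 periods never occur; the barrier bites for n ≥ 3 bodies
(SmoothBodies), which the route deliberately does not file.
- Literature.Barriers.KontsevichZagierPeriods.kzConjecture_implies_ellipticPeriods_algIndep: not
engaged — every transcendence input is LINEAR (HW Cor. 13.13, Masser II/III as tree facts); ϖ², ω·η
products are never claimed transcendental; WeierstrassStoneNotBaker uses only ℚ̄-linear independence
of 1, 2πi, ω₁, η₁.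
- Literature.Barriers.KontsevichZagierPeriods.kzConjecture_implies_twoPiI_log_algIndep: not engaged
for the same reason (GenusZeroStonePairs compares two multiples of ONE number βπ; Baker enters only
as LowDimension's bookkeeping).
- Literature.Barriers.KontsevichZagierPeriods.noSemialgebraicPrimitive_inv_sub_two: respected and
used — the single Newton–Leibniz move of GreenBridge has the polynomial primitive y given in
advance; the cruxes never integrate a variable OUT through a transcendental primitive (log/arctan
layers stay as 1-dim representations over ℝ, exactly the barrier's lesson).
- Literature.Barriers.KontsevichZagierPeriods.cressonViuSos_prop_3_2: not engaged — no global
semialgebraic homeomorphism between two stones is posited except in Coni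

History (route lifecycle, newest last):
- 2026-08-15T13:48:37Z · CLOSED retired — not-a-thesis: assembly does not conclude the sub-problem Statement (operator:999:1257524)

sub-problem: KontsevichZagierPeriods · status: closed(retired) · opened planner-plancard-KontsevichZagierPeriods-Kont-270990d1-0 2026-08-15T12:47:56Z · rev 0 · ledger route-KontsevichZagierPeriods-SmoothStones
GENERATED by the gate from the ledger (D-0016/17). Provers cite these decls: `theorem foo : Summit.KontsevichZagierPeriods.KontsevichZagierPeriods.Theses.SmoothStones.<Decl> := …` in Summits/KontsevichZagierPeriods/KontsevichZagierPeriods/Theorems/<Name>.lean.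
-/

namespace Summit.KontsevichZagierPeriods.KontsevichZagierPeriods.Theses.SmoothStones

open scoped BigOperators Topology Manifold Classical MeasureTheory ProbabilityTheory Matrix InnerProductSpace ComplexConjugate ContinuousMap
open Filter Set Function TopologicalSpace MeasureTheory

attribute [summit_statement] _root_.KontsevichZagierPeriods

open Literature Periods

/-- item stmt-KontsevichZagierPeriods-8418 · target · rank 0 · closed · moot by None · by planner
why it might fail: It is Conjecture 1 verbatim on a sector: false iff two smooth stones of equal area are not connected by the fixed H21 calculus (e.g. a one-oval dividing sextic stone of area βπ vs a disc, if cut-surface Stokes is not a chain of moves) — then the summit is false too.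
sources: KontsevichZagier2001, HuberWustholz2022, Arnold1990
[target] Conjecture 1 on the smooth-stone sector: two 2-dimensional integral representations with
integrand 1 whose domains are smooth stones (compact, regular closed, frontier in the smooth real
locus of some p ∈ ℚ[x,y]) and with equal value are KZ-equivalent. -/
@[route_item "route-KontsevichZagierPeriods-SmoothStones"]
def SmoothOvalSector : Prop :=
  ∀ (r r' : Literature.NumberTheory.Transcendental.KZ.IntegralRep 2), (∀ x ∈ r.domain, r.integrand x = 1) → (∀ x ∈ r'.domain, r'.integrand x = 1) → (IsCompact r.domain ∧ closure (interior r.domain) = r.domain ∧ (interior r.domain).Nonempty ∧ ∃ p : MvPolynomial (Fin 2) ℚ, frontier r.domain ⊆ {x | MvPolynomial.aeval x p = 0 ∧ ∃ i, MvPolynomial.aeval x (MvPolynomial.pderiv i p) ≠ 0}) → (IsCompact r'.domain ∧ closure (interior r'.domain) = r'.domain ∧ (interior r'.domain).Nonempty ∧ ∃ p : MvPolynomial (Fin 2) ℚ, frontier r'.domain ⊆ {x | MvPolynomial.aeval x p = 0 ∧ ∃ i, MvPolynomial.aeval x (MvPolynomial.pderiv i p) ≠ 0}) → r.value = r'.value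 → Literature.NumberTheory.Transcendental.KZ.Equivalent r r'

/-- item stmt-KontsevichZagierPeriods-8419 · crux · rank 2 · closed · moot by None · by planner
why it might fail: HW relations among complete periods also involve non-split torus extensions of J(C) (third-kind parts of x dy at the points at infinity) and CM/isogeny factors; one equal-area pair whose certificate no sheetwise correspondence + plane Stokes chain realises refutes it (and the summit).
sources: HuberWustholz2022, Masser1975, SertozOuaknineWorrell2025, KontsevichZagier2001
[crux] The abelian half (card (S), hardest): two smooth stones with equal area NOT of the form β·π
(β real algebraic) are KZ-equivalent. After the Green move both areas are complete periods of
second/third-kind forms on smooth curves of genus ≥ 1; by Huber–Wüstholz the equality is induced by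
exact forms, residues and a correspondence / endomorphism between the generalised Jacobians (incl.
isogenies, CM, decomposable Jacobians as in HW Ex. 14.5(3): y² = x⁶+1 → y² = x³+1); the claim is
that every such certificate is a chain of moves (fold maps (x,y) ↦ (x²,y) are single 2-dim changes
of variables on half-stones; general correspondences act sheetwise as in route MultivaluedCoV;
isogenies as in IsogenyCertificates/HermiteRigidity). Test pairs: {x⁴+y² ≤ 1} (area 4ϖ/3) against
Weierstrass stones of y² = x³ − x; the genus-2 stone {x⁶ + y² ≤ 1} (area (2/3)B(1/6,3/2) =
3.6429759718) against stones of its elliptic quotients. [deps: GreenBridge] [difficulty: XL] -/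
@[route_item "route-KontsevichZagierPeriods-SmoothStones"]
def AbelianStonePairs : Prop :=
  ∀ (r r' : Literature.NumberTheory.Transcendental.KZ.IntegralRep 2), (∀ x ∈ r.domain, r.integrand x = 1) → (∀ x ∈ r'.domain, r'.integrand x = 1) → (IsCompact r.domain ∧ closure (interior r.domain) = r.domain ∧ (interior r.domain).Nonempty ∧ ∃ p : MvPolynomial (Fin 2) ℚ, frontier r.domain ⊆ {x | MvPolynomial.aeval x p = 0 ∧ ∃ i, MvPolynomial.aeval x (MvPolynomial.pderiv i p) ≠ 0}) → (IsCompact r'.domain ∧ closure (interior r'.domain) = r'.domain ∧ (interior r'.domain).Nonempty ∧ ∃ p : MvPolynomial (Fin 2) ℚ, frontier r'.domain ⊆ {x | MvPolynomial.aeval x p = 0 ∧ ∃ i, MvPolynomial.aeval x (MvPolynomial.pderiv i p) ≠ 0}) → (¬ ∃ β : ℝ, IsAlgebraic ℚ β ∧ r.value = β * Real.pi) → r.value = r'.value → Literature.NumberTheory.Transcendental.KZ.Equivalent r r'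

/-- item stmt-KontsevichZagierPeriods-8420 · crux · rank 3 · closed · moot by None · by planner
why it might fail: Area = βπ is certified by residues on a 2-chain in the complexified curve; as moves this needs Stokes on a semialgebraic 2-chain in ℝ⁴ (open crux of UnfoldedStokes) or a parametrisation; the first non-rational instance (one-oval dividing sextic, genus 2) may admit neither.
sources: HuberWustholz2022, KontsevichZagier2001, Arnold1990, BochnakCosteRoy1998
[crux] The bounding half: two smooth stones with equal area of the form β·π (β real algebraic) are
KZ-equivalent. This is the case where the oriented boundary cycle bounds in the complexified curve
and Area = 2πi·Σ residues of x dy (all genus-0 stones: ellipses, ovals of rational quartics with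
non-real or acnodal singularities; ovals of one-oval dividing curves of even genus); the chain must
realise the residue theorem — by a rational parametrisation (genus 0, crux 4) or by Stokes on a
semialgebraic 2-chain of the complex curve in ℝ⁴ (UnfoldedStokes' engine) — and then connect two
π-multiples (disc normal form: [K,1] ~ dilate of the unit disc by √β, one change of variables with
algebraic Jacobian). [deps: GreenBridge, GenusZeroStonePairs] [difficulty: L] -/
@[route_item "route-KontsevichZagierPeriods-SmoothStones"]
def BoundingStonePairs : Prop :=
  ∀ (r r' : Literature.NumberTheory.Transcendental.KZ.IntegralRep 2), (∀ x ∈ r.domain, r.integrand x = 1) → (∀ x ∈ r'.domain, r'.integrand x = 1) → (IsCompact r.domain ∧ closure (interior r.domain) = r.domain ∧ (interior r.domain).Nonempty ∧ ∃ p : MvPolynomial (Fin 2) ℚ, frontier r.domain ⊆ {x | MvPolynomial.aeval x p = 0 ∧ ∃ i, MvPolynomial.aeval x (MvPolynomial.pderiv i p) ≠ 0}) → (IsCompact r'.domain ∧ closure (interior r'.domain) = r'.domain ∧ (interior r'.domain).Nonempty ∧ ∃ p : MvPolynomial (Fin 2) ℚ, frontier r'.domain ⊆ {x | MvPolynomial.aeval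 x p = 0 ∧ ∃ i, MvPolynomial.aeval x (MvPolynomial.pderiv i p) ≠ 0}) → (∃ β : ℝ, IsAlgebraic ℚ β ∧ r.value = β * Real.pi) → r.value = r'.value → Literature.NumberTheory.Transcendental.KZ.Equivalent r r'

/-- item stmt-KontsevichZagierPeriods-8421 · crux · rank 4 · closed · moot by None · by planner
why it might fail: After Green + parametrisation both areas are ∫_ℝ R(t)dt, R ∈ (ℚ̄∩ℝ)(t); connecting two such reps is LowDimension's open d = 1 transfer for ℚ̄-coefficient rational integrands on ℝ (log-divergent partial fractions must pair up inside absolutely convergent reps).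
sources: KontsevichZagier2001, Baker1975, Arnold1990, HuberWustholz2022
[crux] Genus-zero stones (special case of crux 3, first to attack): if the frontiers of both stones
are covered by finitely many real-algebraically parametrised rational arcs t ↦ (u(t)/w(t),
v(t)/w(t)) (u, v, w ∈ (ℚ̄∩ℝ)[t], w without real zeros), equal area implies KZ-equivalence. Plan:
Green move (support GreenBridge), then the parametrisation is ONE change of variables per oval
turning ∮ x dy into the 1-dim representation [ℝ, (u/w)·(v/w)′] with rational integrand over ℚ̄∩ℝ,
value β·π by residues (β = 2i·Σ_{Im>0} res, real algebraic, > 0); two such representations with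
equal value are connected by LowDimension's d = 1 machinery (partial fractions, Möbius changes of
variables preserving dt/(1+t²), Baker only for bookkeeping since both values are rational multiples
of the same π·β). [deps: GreenBridge] [difficulty: M] -/
@[route_item "route-KontsevichZagierPeriods-SmoothStones"]
def GenusZeroStonePairs : Prop :=
  ∀ (r r' : Literature.NumberTheory.Transcendental.KZ.IntegralRep 2), (∀ x ∈ r.domain, r.integrand x = 1) → (∀ x ∈ r'.domain, r'.integrand x = 1) → (IsCompact r.domain ∧ closure (interior r.domain) = r.domain ∧ (interior r.domain).Nonempty ∧ ∃ p : MvPolynomial (Fin 2) ℚ, frontier r.domain ⊆ {x | MvPolynomial.aeval x p = 0 ∧ ∃ i, MvPolynomial.aeval x (MvPolynomial.pderiv i p) ≠ 0}) → (IsCompact r'.domain ∧ closure (interior r'.domain) = r'.domain ∧ (interior r'.domain).Nonempty ∧ ∃ p : MvPolynomial (Fin 2) ℚ, frontier r'.domain ⊆ {x | MvPolynomial.aeval x p = 0 ∧ ∃ i, MvPolynomial.aeval x (MvPolynomial.pderiv i p) ≠ 0}) → (∃ (k : ℕ) (u v w : Fin k → Polynomial ℝ), (∀ i n, IsAlgebraic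 ℚ ((u i).coeff n) ∧ IsAlgebraic ℚ ((v i).coeff n) ∧ IsAlgebraic ℚ ((w i).coeff n)) ∧ (∀ i t, (w i).eval t ≠ 0) ∧ frontier r.domain ⊆ ⋃ i, closure (Set.range fun t : ℝ => (![(u i).eval t / (w i).eval t, (v i).eval t / (w i).eval t] : Fin 2 → ℝ))) → (∃ (k : ℕ) (u v w : Fin k → Polynomial ℝ), (∀ i n, IsAlgebraic ℚ ((u i).coeff n) ∧ IsAlgebraic ℚ ((v i).coeff n) ∧ IsAlgebraic ℚ ((w i).coeff n)) ∧ (∀ i t, (w i).eval t ≠ 0) ∧ frontier r'.domain ⊆ ⋃ i, closure (Set.range fun t : ℝ => (![(u i).eval t / (w i).eval t, (v i).eval t / (w i).eval t] : Fin 2 → ℝ))) → r.value = r'.value → Literature.NumberTheory.Transcendental.KZ.Equivalent r r'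

/-- item stmt-KontsevichZagierPeriods-8422 · crux · rank 5 · closed · moot by None · by planner
why it might fail: Only via a bookkeeping leak — 'frontier of a compact regular-closed set in the smooth real locus = finitely many whole ovals and Area = Σ±∮x dy' (Green for semialgebraic stones) — or if the inlined plane-curve closed-path form overstated HW Cor. 13.13 for reducible p (checked vs Thm 9.10: no).
sources: HuberWustholz2022, Wustholz1989, Arnold1990, Masser2026
[crux] Leibniz's problem for whole ovals (card (T1a), 'a smooth stone never weighs an algebraic
amount'): ASSUMING the plane-curve closed-path form of Huber–Wüstholz 2022 Cor. 13.13 / Thm 9.10,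
inlined as the hypothesis (for p, A, B ∈ ℚ[x,y] and finitely many C¹ closed loops γᵢ in the smooth
complex locus of p = 0, an algebraic value of Σ nᵢ ∮_γᵢ (A dx + B dy) is zero), every smooth stone σ
has transcendental area. Proof: frontier σ = finitely many smooth ovals (local one-sidedness of a
regular closed set along a smooth arc), Area(σ) = Σ ± ∮ x dy > 0 (Green / Fubini cell by cell),
apply the hypothesis with A = 0, B = x. The hypothesis is to be vendored as a Literature fact (cite
item filed); by soundness (`KZ.Equivalent.value_eq_holds`) the theorem separates every smooth stone
from every representation with algebraic value (polygons, Arnold's nodal loop of area 2/3).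
[difficulty: L] -/
@[route_item "route-KontsevichZagierPeriods-SmoothStones"]
def SmoothStonesTranscendental : Prop :=
  (∀ (p A B : MvPolynomial (Fin 2) ℚ) (k : ℕ) (n : Fin k → ℤ) (γ : Fin k → ℝ → (Fin 2 → ℂ)), (∀ i, ContDiff ℝ 1 (γ i) ∧ Function.Periodic (γ i) 1 ∧ ∀ t, MvPolynomial.aeval (γ i t) p = 0 ∧ ∃ j, MvPolynomial.aeval (γ i t) (MvPolynomial.pderiv j p) ≠ 0) → IsAlgebraic ℚ (∑ i, (n i : ℂ) * ∫ t in (0:ℝ)..1, (MvPolynomial.aeval (γ i t) A * deriv (fun s => γ i s 0) t + MvPolynomial.aeval (γ i t) B * deriv (fun s => γ i s 1) t)) → (∑ i, (n i : ℂ) * ∫ t in (0:ℝ)..1, (MvPolynomial.aeval (γ i t) A * deriv (fun s => γ i s 0) t + MvPolynomial.aeval (γ i t) B * deriv (fun s => γ i s 1) t)) = 0) → ∀ (σ : Set (Fin 2 → ℝ)), IsCompact σ → closure (interior σ) = σ → (interior σ).Nonempty → (∃ p : MvPolynomial (Fin 2) ℚ, frontier σ ⊆ {x | MvPolynomial.aeval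 x p = 0 ∧ ∃ i, MvPolynomial.aeval x (MvPolynomial.pderiv i p) ≠ 0}) → Transcendental ℚ (MeasureTheory.volume σ).toReal

/-- item stmt-KontsevichZagierPeriods-8423 · support · rank 9 · closed · moot by None · by planner
sources: KontsevichZagier2001, BochnakCosteRoy1998
[support] Sanity anchor of the sector (d = 2 analogue of LowDimension's DimZero): two smooth stones
cut by conics (p of total degree ≤ 2, i.e. filled ellipses over ℚ) with equal area are KZ-equivalent
— one affine change of variables with real-algebraic entries and Jacobian ±1 (its graph is
ℚ-semialgebraic), e.g. {x²+4y² ≤ 4} ~ {x²+y² ≤ 2} via (x,y) ↦ (x/√2, √2·y). [difficulty: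
provable-now] -/
@[route_item "route-KontsevichZagierPeriods-SmoothStones"]
def ConicStones : Prop :=
  ∀ (r r' : Literature.NumberTheory.Transcendental.KZ.IntegralRep 2), (∀ x ∈ r.domain, r.integrand x = 1) → (∀ x ∈ r'.domain, r'.integrand x = 1) → (IsCompact r.domain ∧ closure (interior r.domain) = r.domain ∧ (interior r.domain).Nonempty ∧ ∃ p : MvPolynomial (Fin 2) ℚ, p.totalDegree ≤ 2 ∧ frontier r.domain ⊆ {x | MvPolynomial.aeval x p = 0 ∧ ∃ i, MvPolynomial.aeval x (MvPolynomial.pderiv i p) ≠ 0}) → (IsCompact r'.domain ∧ closure (interior r'.domain) = r'.domain ∧ (interior r'.domain).Nonempty ∧ ∃ p : MvPolynomial (Fin 2) ℚ, p.totalDegree ≤ 2 ∧ frontier r'.domain ⊆ {x | MvPolynomial.aeval x p = 0 ∧ ∃ i, MvPolynomial.aeval x (MvPolynomial.pderiv i p) ≠ 0}) → r.value = r'.value → Literature.NumberTheory.Transcendental.KZ.Equivalent r r'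

/-- item stmt-KontsevichZagierPeriods-8424 · support · rank 9 · closed · moot by None · by planner
sources: Masser1975, Lawden1989, HuberWustholz2022, KontsevichZagier2001
[support] Card (T1c) typed over the tree's facts: for a real lattice L with rational invariants q₂,
q₃ and positive discriminant (f = 4x³ − q₂x − q₃ with real roots e₃ < e₂ < e₁), the Weierstrass
stone {(x,y) : y² ≤ f(x), x < e₁} = {e₃ ≤ x ≤ e₂, y² ≤ f(x)} has area 2∫_{e₃}^{e₂} √f = −(2/5)q₂·H −
(3/5)q₃·Ω₀, where Ω₀ = 2∫_{e₃}^{e₂} dx/√f is the least real period (tree fact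
`PeriodPair.IsReal.integral_inv_sqrt_cubic_of_discr_pos`) and H = 2∫_{e₃}^{e₂} x dx/√f the
quasi-period of the same cycle (from d(xy) = (10x³ − (3/2)q₂x − q₃)dx/y; checked numerically to
5·10⁻¹³ for q₂ = 28, q₃ = −24: Ω₀ = 2.0189058200, H = −1.2325555232, Area = 42.876865668); hence, by
Masser's Theorems II and III (ℚ̄-independence of 1, 2πi, ω₁, η₁, tree corollary
`qbarLinearIndependent_one_twoPiI_ω₁_η₁`) and (q₂,q₃) ≠ (0,0), the area is never γ + β·π with β, γ
real algebraic: a smooth cubic stone is neither rational nor commensurable with the disc.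
[difficulty: L] -/
@[route_item "route-KontsevichZagierPeriods-SmoothStones"]
def WeierstrassStoneNotBaker : Prop :=
  Literature.NumberTheory.Transcendental.masser_ellipticPeriods → Literature.NumberTheory.Transcendental.masser_ellipticPeriods_cm → ∀ (L : PeriodPair) (q₂ q₃ : ℚ), L.IsReal → L.g₂ = (q₂ : ℂ) → L.g₃ = (q₃ : ℂ) → 0 < (q₂ : ℝ) ^ 3 - 27 * (q₃ : ℝ) ^ 2 → ∀ (β γ : ℝ), IsAlgebraic ℚ β → IsAlgebraic ℚ γ → (MeasureTheory.volume {v : Fin 2 → ℝ | v 1 ^ 2 ≤ 4 * v 0 ^ 3 - (q₂ : ℝ) * v 0 - q₃ ∧ ∃ t : ℝ, v 0 < t ∧ 4 * t ^ 3 - (q₂ : ℝ) * t - q₃ < 0}).toReal ≠ γ + β * Real.pi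

/-- item stmt-KontsevichZagierPeriods-8425 · support · rank 9 · closed · moot by None · by planner
sources: KontsevichZagier2001, BasuPollackRoy2006, BochnakCosteRoy1998
[support] The Green move inside the rules (card W1): every integrand-1 representation over a smooth
stone is congruent modulo `KZ.relations` to a ℤ-combination of 1-dimensional representations (typed
loosely; the intended chain produces integrands that are differences y_top(x) − y_bot(x) of two real
branches of the boundary curve over x-intervals: cylindrical decomposition of the stone into
vertical bands — rule 1a, null walls are relations — and ONE Newton–Leibniz move per band with the
polynomial primitive F = y; provers of cruxes 2–4 re-prove the sharp form they need with
`--supports`). [difficulty: M] -/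
@[route_item "route-KontsevichZagierPeriods-SmoothStones"]
def GreenBridge : Prop :=
  ∀ (r : Literature.NumberTheory.Transcendental.KZ.IntegralRep 2), (∀ x ∈ r.domain, r.integrand x = 1) → (IsCompact r.domain ∧ closure (interior r.domain) = r.domain ∧ (interior r.domain).Nonempty ∧ ∃ p : MvPolynomial (Fin 2) ℚ, frontier r.domain ⊆ {x | MvPolynomial.aeval x p = 0 ∧ ∃ i, MvPolynomial.aeval x (MvPolynomial.pderiv i p) ≠ 0}) → ∃ c ∈ AddSubgroup.closure {x : Literature.NumberTheory.Transcendental.KZ.FormalRep | ∃ (s : Literature.NumberTheory.Transcendental.KZ.IntegralRep 1), x = Literature.NumberTheory.Transcendental.KZ.of s}, Literature.NumberTheory.Transcendental.KZ.of r - c ∈ Literature.NumberTheory.Transcendental.KZ.relations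

/-- item stmt-KontsevichZagierPeriods-8426 · support · rank 9 · closed · moot by None · by planner
sources: KontsevichZagier2001
[support] The sector is a literal special case of the summit: integrand 1 is KZ-rational (p = q =
1), so `KontsevichZagierPeriods → SmoothOvalSector` (three lines, proved in the folder's Sketch.lean
as `sectorOfSummit_holds`); it makes the kill criterion formal (¬SmoothOvalSector ⇒ ¬summit).
[difficulty: provable-now] -/
@[route_item "route-KontsevichZagierPeriods-SmoothStones"]
def SectorOfSummit : Prop :=
  KontsevichZagierPeriods → SmoothOvalSector

/-- item stmt-KontsevichZagierPeriods-8427 · assembly · rank 1 · closed · moot by None · by planner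
sources: KontsevichZagier2001, HuberWustholz2022
[assembly] BoundingStonePairs → AbelianStonePairs → SmoothOvalSector (case split on Area ∈ ℚ̄·π). -/
@[route_item "route-KontsevichZagierPeriods-SmoothStones"]
def Assembly : Prop :=
  BoundingStonePairs → AbelianStonePairs → SmoothOvalSector

end Summit.KontsevichZagierPeriods.KontsevichZagierPeriods.Theses.SmoothStones
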